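import Summits.Ventures.PercRepro.RankLevelSetLevelSixHeavyCellSq
import Summits.Ventures.PercRepro.RankLevelSetLevelSixArithHeavySqA
import Summits.Ventures.PercRepro.RankLevelSetLevelSixArithHeavySqB
import Summits.Ventures.PercRepro.RankLevelSetLevelSixArithHeavySqC
import Summits.Ventures.PercRepro.RankLevelSetLevelSixArithHeavySqD
import Summits.Ventures.PercRepro.RankLevelSetLevelSixArithHeavySqE
import Summits.Ventures.PercRepro.RankLevelSetLevelSixArithHeavySqF
import Summits.Ventures.PercRepro.RankLevelSetLevelSixArithHeavySqG
import Summits.Ventures.PercRepro.RankLevelSetLevelSixArithHeavySqH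
import Summits.Ventures.PercRepro.RankLevelSetLevelSixArithHeavySqI
import Summits.Ventures.PercRepro.S3SixWindow
import Summits.Ventures.PercRepro.RankLevelSetCoreSixFiftyTwo
import Summits.Ventures.PercRepro.RankLevelSetLevelFivePart

/-!
# PercRepro — C-025 AT LEVEL `6` FOR EVERY `p ≥ 52`, SELF-CONTAINED (p8, S3)

`proofs/SUBCLAIM-S3-p8.md` §3g. A self-contained re-statement of RankLevelSetLevelSixHeavySq (its olean had not been
built 65 minutes after its landing) under primed names, plus the glue on p7's `c025_five_large_part33`. The core cells `(p, 7 ≤ d ≤ 50)` at `p ≥ 52` by `c025_core_six_heavy_cell_sq`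
(RankLevelSetLevelSixHeavyCellSq: p7's square multiplicity, rational tails `Kn/1000`) with the per-corank parameters of
RankLevelSetLevelSixArithHeavySqA … I (`c025_core_six_bounded_corank_heavy_sq'`); the cells `d ≥ 51` by
`c025_core_six_fortythree_fiftytwo` (`52 ≤ p`); level `5` for `p ≥ 51` gives level `6` for `p ≥ 52`
(`c025_six_of_five_heavy_sq'`: rank `52` by `rls_six_at_of_core`, ranks `≥ 53` by `rls_succ_large`). `52` is the
floor of the counting route at level `6`: the cells `(p, d ≥ 51)` need `p ≥ 52` (d1067) and at `p ≤ d` the spanning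
sets are the majority of all subsets. On p7's `c025_five_large_part33 (33 ≤ p)` (RankLevelSetLevelFivePart): **`c025_six_large_fifty_two (52 ≤ p) : RLS M p 6`**,
every finite matroid, unconditional over the tree — the floor of the counting route. Axioms: standard.
-/

open scoped Matroid

namespace PercRepro

namespace ThmN

open Set

variable {α : Type}

/-- **The `e`-free core at level `6`, corank `7 ≤ d ≤ 50`, rank `p ≥ 52`** (square multiplicity, rational tails). -/
theorem c025_core_six_bounded_corank_heavy_sq' (M : Matroid α) [M.Finite] (p d : ℕ) (hp : 52 ≤ p) (hd7 : 7 ≤ d)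
    (hd50 : d ≤ 50) (hR : M.eRank = (p : ℕ∞)) (hn : M.E.ncard = p + d)
    (hfree : ∀ e ∈ M.E, ∃ A ⊆ M.E \ {e}, e ∉ M.closure A ∧ e ∉ M.closure ((M.E \ {e}) \ A)) :
    RLS M p 6 := by
  interval_cases d
  · exact c025_core_six_heavy_cell_sq M p 7 7 1 1 13 12 0 104334330 1000 13
      (by norm_num) (by norm_num) (by norm_num) (by norm_num) (by norm_num) (by norm_num) (by norm_num)
      (by norm_num [cnull]) (by norm_num [cnull]) (by norm_num) (Or.inl (by norm_num)) (Or.inl (by norm_num)) (by norm_num) (by norm_num) (by norm_num)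
      (tail_six_heavy_sq_7 (p + 7) (by omega)) hR hn hfree (level_six_poly_heavy_sq_7 p hp)
  · exact c025_core_six_heavy_cell_sq M p 8 7 2 1 16 14 0 47345961 1000 14
      (by norm_num) (by norm_num) (by norm_num) (by norm_num) (by norm_num) (by norm_num) (by norm_num)
      (by norm_num [cnull]) (by norm_num [cnull]) (by norm_num) (Or.inl (by norm_num)) (Or.inl (by norm_num)) (by norm_num) (by norm_num) (by norm_num)
      (tail_six_heavy_sq_8 (p + 8) (by omega)) hR hn hfree (level_six_poly_heavy_sq_8 p hp)
  · exact c025_core_six_heavy_cell_sq M p 9 7 2 1 19 16 0 22626074 1000 15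
      (by norm_num) (by norm_num) (by norm_num) (by norm_num) (by norm_num) (by norm_num) (by norm_num)
      (by norm_num [cnull]) (by norm_num [cnull]) (by norm_num) (Or.inl (by norm_num)) (Or.inl (by norm_num)) (by norm_num) (by norm_num) (by norm_num)
      (tail_six_heavy_sq_9 (p + 9) (by omega)) hR hn hfree (level_six_poly_heavy_sq_9 p hp)
  · exact c025_core_six_heavy_cell_sq M p 10 7 2 1 22 18 0 11338880 1000 16
      (by norm_num) (by norm_num) (by norm_num) (by norm_num) (by norm_num) (by norm_num) (by norm_num)
      (by norm_num [cnull]) (by norm_num [cnull]) (by norm_num) (Or.inl (by norm_num)) (Or.inl (by norm_num)) (by norm_num) (by norm_num) (by norm_num)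
      (tail_six_heavy_sq_10 (p + 10) (by omega)) hR hn hfree (level_six_poly_heavy_sq_10 p hp)
  · exact c025_core_six_heavy_cell_sq M p 11 8 2 1 23 19 0 5936890 1000 17
      (by norm_num) (by norm_num) (by norm_num) (by norm_num) (by norm_num) (by norm_num) (by norm_num)
      (by norm_num [cnull]) (by norm_num [cnull]) (by norm_num) (Or.inl (by norm_num)) (Or.inl (by norm_num)) (by norm_num) (by norm_num) (by norm_num)
      (tail_six_heavy_sq_11 (p + 11) (by omega)) hR hn hfree (level_six_poly_heavy_sq_11 p hp)
  · exact c025_core_six_heavy_cell_sq M p 12 8 2 1 26 21 0 3237110 1000 18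
      (by norm_num) (by norm_num) (by norm_num) (by norm_num) (by norm_num) (by norm_num) (by norm_num)
      (by norm_num [cnull]) (by norm_num [cnull]) (by norm_num) (Or.inl (by norm_num)) (Or.inl (by norm_num)) (by norm_num) (by norm_num) (by norm_num)
      (tail_six_heavy_sq_12 (p + 12) (by omega)) hR hn hfree (level_six_poly_heavy_sq_12 p hp)
  · exact c025_core_six_heavy_cell_sq M p 13 9 2 1 27 22 0 1832756 1000 19
      (by norm_num) (by norm_num) (by norm_num) (by norm_num) (by norm_num) (by norm_num) (by norm_num)
      (by norm_num [cnull]) (by norm_num [cnull]) (by norm_num) (Or.inl (by norm_num)) (Or.inl (by norm_num)) (by norm_num) (by norm_num) (by norm_num)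
      (tail_six_heavy_sq_13 (p + 13) (by omega)) hR hn hfree (level_six_poly_heavy_sq_13 p hp)
  · exact c025_core_six_heavy_cell_sq M p 14 10 2 1 28 23 0 1074660 1000 20
      (by norm_num) (by norm_num) (by norm_num) (by norm_num) (by norm_num) (by norm_num) (by norm_num)
      (by norm_num [cnull]) (by norm_num [cnull]) (by norm_num) (Or.inl (by norm_num)) (Or.inl (by norm_num)) (by norm_num) (by norm_num) (by norm_num)
      (tail_six_heavy_sq_14 (p + 14) (by omega)) hR hn hfree (level_six_poly_heavy_sq_14 p hp)
  · exact c025_core_six_heavy_cell_sq M p 15 11 1 1 25 20 0 651088 1000 21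
      (by norm_num) (by norm_num) (by norm_num) (by norm_num) (by norm_num) (by norm_num) (by norm_num)
      (by norm_num [cnull]) (by norm_num [cnull]) (by norm_num) (Or.inr (Or.inl ⟨by norm_num, by norm_num⟩)) (Or.inl (by norm_num)) (by norm_num) (by norm_num) (by norm_num)
      (tail_six_heavy_sq_15 (p + 15) (by omega)) hR hn hfree (level_six_poly_heavy_sq_15 p hp)
  · exact c025_core_six_heavy_cell_sq M p 16 12 1 1 26 21 0 406714 1000 22
      (by norm_num) (by norm_num) (by norm_num) (by norm_num) (by norm_num) (by norm_num) (by norm_num)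
      (by norm_num [cnull]) (by norm_num [cnull]) (by norm_num) (Or.inr (Or.inl ⟨by norm_num, by norm_num⟩)) (Or.inl (by norm_num)) (by norm_num) (by norm_num) (by norm_num)
      (tail_six_heavy_sq_16 (p + 16) (by omega)) hR hn hfree (level_six_poly_heavy_sq_16 p hp)
  · exact c025_core_six_heavy_cell_sq M p 17 12 1 1 28 21 0 261443 1000 23
      (by norm_num) (by norm_num) (by norm_num) (by norm_num) (by norm_num) (by norm_num) (by norm_num)
      (by norm_num [cnull]) (by norm_num [cnull]) (by norm_num) (Or.inr (Or.inl ⟨by norm_num, by norm_num⟩)) (Or.inl (by norm_num)) (by norm_num) (by norm_num) (by norm_num)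
      (tail_six_heavy_sq_17 (p + 17) (by omega)) hR hn hfree (level_six_poly_heavy_sq_17 p hp)
  · exact c025_core_six_heavy_cell_sq M p 18 13 1 1 29 21 0 172638 1000 24
      (by norm_num) (by norm_num) (by norm_num) (by norm_num) (by norm_num) (by norm_num) (by norm_num)
      (by norm_num [cnull]) (by norm_num [cnull]) (by norm_num) (Or.inr (Or.inl ⟨by norm_num, by norm_num⟩)) (Or.inl (by norm_num)) (by norm_num) (by norm_num) (by norm_num)
      (tail_six_heavy_sq_18 (p + 18) (by omega)) hR hn hfree (level_six_poly_heavy_sq_18 p hp)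
  · exact c025_core_six_heavy_cell_sq M p 19 13 1 1 31 21 0 116911 1000 25
      (by norm_num) (by norm_num) (by norm_num) (by norm_num) (by norm_num) (by norm_num) (by norm_num)
      (by norm_num [cnull]) (by norm_num [cnull]) (by norm_num) (Or.inr (Or.inl ⟨by norm_num, by norm_num⟩)) (Or.inl (by norm_num)) (by norm_num) (by norm_num) (by norm_num)
      (tail_six_heavy_sq_19 (p + 19) (by omega)) hR hn hfree (level_six_poly_heavy_sq_19 p hp)
  · exact c025_core_six_heavy_cell_sq M p 20 14 1 1 32 21 0 81074 1000 26
      (by norm_num) (by norm_num) (by norm_num) (by norm_num) (by norm_num) (by norm_num) (by norm_num)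
      (by norm_num [cnull]) (by norm_num [cnull]) (by norm_num) (Or.inr (Or.inl ⟨by norm_num, by norm_num⟩)) (Or.inl (by norm_num)) (by norm_num) (by norm_num) (by norm_num)
      (tail_six_heavy_sq_20 (p + 20) (by omega)) hR hn hfree (level_six_poly_heavy_sq_20 p hp)
  · exact c025_core_six_heavy_cell_sq M p 21 14 1 1 34 21 0 57492 1000 27
      (by norm_num) (by norm_num) (by norm_num) (by norm_num) (by norm_num) (by norm_num) (by norm_num)
      (by norm_num [cnull]) (by norm_num [cnull]) (by norm_num) (Or.inr (Or.inl ⟨by norm_num, by norm_num⟩)) (Or.inl (by norm_num)) (by norm_num) (by norm_num) (by norm_num)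
      (tail_six_heavy_sq_21 (p + 21) (by omega)) hR hn hfree (level_six_poly_heavy_sq_21 p hp)
  · exact c025_core_six_heavy_cell_sq M p 22 15 1 1 35 21 0 41635 1000 28
      (by norm_num) (by norm_num) (by norm_num) (by norm_num) (by norm_num) (by norm_num) (by norm_num)
      (by norm_num [cnull]) (by norm_num [cnull]) (by norm_num) (Or.inr (Or.inl ⟨by norm_num, by norm_num⟩)) (Or.inl (by norm_num)) (by norm_num) (by norm_num) (by norm_num)
      (tail_six_heavy_sq_22 (p + 22) (by omega)) hR hn hfree (level_six_poly_heavy_sq_22 p hp)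
  · exact c025_core_six_heavy_cell_sq M p 23 15 1 1 37 21 0 30755 1000 29
      (by norm_num) (by norm_num) (by norm_num) (by norm_num) (by norm_num) (by norm_num) (by norm_num)
      (by norm_num [cnull]) (by norm_num [cnull]) (by norm_num) (Or.inr (Or.inl ⟨by norm_num, by norm_num⟩)) (Or.inl (by norm_num)) (by norm_num) (by norm_num) (by norm_num)
      (tail_six_heavy_sq_23 (p + 23) (by omega)) hR hn hfree (level_six_poly_heavy_sq_23 p hp)
  · exact c025_core_six_heavy_cell_sq M p 24 16 1 1 38 21 0 23146 1000 30
      (by norm_num) (by norm_num) (by norm_num) (by norm_num) (by norm_num) (by norm_num) (by norm_num)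
      (by norm_num [cnull]) (by norm_num [cnull]) (by norm_num) (Or.inr (Or.inl ⟨by norm_num, by norm_num⟩)) (Or.inl (by norm_num)) (by norm_num) (by norm_num) (by norm_num)
      (tail_six_heavy_sq_24 (p + 24) (by omega)) hR hn hfree (level_six_poly_heavy_sq_24 p hp)
  · exact c025_core_six_heavy_cell_sq M p 25 17 1 1 39 0 0 17728 1000 31
      (by norm_num) (by norm_num) (by norm_num) (by norm_num) (by norm_num) (by norm_num) (by norm_num)
      (by norm_num [cnull]) (by norm_num [cnull]) (by norm_num) (Or.inr (Or.inr (by norm_num))) (Or.inl (by norm_num)) (by norm_num) (by norm_num) (by norm_num)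
      (tail_six_heavy_sq_25 (p + 25) (by omega)) hR hn hfree (level_six_poly_heavy_sq_25 p hp)
  · exact c025_core_six_heavy_cell_sq M p 26 17 1 1 41 0 0 13805 1000 32
      (by norm_num) (by norm_num) (by norm_num) (by norm_num) (by norm_num) (by norm_num) (by norm_num)
      (by norm_num [cnull]) (by norm_num [cnull]) (by norm_num) (Or.inr (Or.inr (by norm_num))) (Or.inl (by norm_num)) (by norm_num) (by norm_num) (by norm_num)
      (tail_six_heavy_sq_26 (p + 26) (by omega)) hR hn hfree (level_six_poly_heavy_sq_26 p hp)
  · exact c025_core_six_heavy_cell_sq M p 27 19 1 1 41 0 1 10919 1000 33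
      (by norm_num) (by norm_num) (by norm_num) (by norm_num) (by norm_num) (by norm_num) (by norm_num)
      (by norm_num [cnull]) (by norm_num [cnull]) (by norm_num) (Or.inr (Or.inr (by norm_num))) (Or.inr rfl) (by norm_num) (by norm_num) (by norm_num)
      (tail_six_heavy_sq_27 (p + 27) (by omega)) hR hn hfree (level_six_poly_heavy_sq_27 p hp)
  · exact c025_core_six_heavy_cell_sq M p 28 20 1 1 42 0 1 8764 1000 34
      (by norm_num) (by norm_num) (by norm_num) (by norm_num) (by norm_num) (by norm_num) (by norm_num)
      (by norm_num [cnull]) (by norm_num [cnull]) (by norm_num) (Or.inr (Or.inr (by norm_num))) (Or.inr rfl) (by norm_num) (by norm_num) (by norm_num)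
      (tail_six_heavy_sq_28 (p + 28) (by omega)) hR hn hfree (level_six_poly_heavy_sq_28 p hp)
  · exact c025_core_six_heavy_cell_sq M p 29 21 1 1 43 0 1 7132 1000 35
      (by norm_num) (by norm_num) (by norm_num) (by norm_num) (by norm_num) (by norm_num) (by norm_num)
      (by norm_num [cnull]) (by norm_num [cnull]) (by norm_num) (Or.inr (Or.inr (by norm_num))) (Or.inr rfl) (by norm_num) (by norm_num) (by norm_num)
      (tail_six_heavy_sq_29 (p + 29) (by omega)) hR hn hfree (level_six_poly_heavy_sq_29 p hp)
  · exact c025_core_six_heavy_cell_sq M p 30 22 1 1 44 0 1 5880 1000 36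
      (by norm_num) (by norm_num) (by norm_num) (by norm_num) (by norm_num) (by norm_num) (by norm_num)
      (by norm_num [cnull]) (by norm_num [cnull]) (by norm_num) (Or.inr (Or.inr (by norm_num))) (Or.inr rfl) (by norm_num) (by norm_num) (by norm_num)
      (tail_six_heavy_sq_30 (p + 30) (by omega)) hR hn hfree (level_six_poly_heavy_sq_30 p hp)
  · exact c025_core_six_heavy_cell_sq M p 31 23 1 1 45 0 1 4907 1000 37
      (by norm_num) (by norm_num) (by norm_num) (by norm_num) (by norm_num) (by norm_num) (by norm_num)
      (by norm_num [cnull]) (by norm_num [cnull]) (by norm_num) (Or.inr (Or.inr (by norm_num))) (Or.inr rfl) (by norm_num) (by norm_num) (by norm_num)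
      (tail_six_heavy_sq_31 (p + 31) (by omega)) hR hn hfree (level_six_poly_heavy_sq_31 p hp)
  · exact c025_core_six_heavy_cell_sq M p 32 24 1 1 46 0 1 4143 1000 38
      (by norm_num) (by norm_num) (by norm_num) (by norm_num) (by norm_num) (by norm_num) (by norm_num)
      (by norm_num [cnull]) (by norm_num [cnull]) (by norm_num) (Or.inr (Or.inr (by norm_num))) (Or.inr rfl) (by norm_num) (by norm_num) (by norm_num)
      (tail_six_heavy_sq_32 (p + 32) (by omega)) hR hn hfree (level_six_poly_heavy_sq_32 p hp)
  · exact c025_core_six_heavy_cell_sq M p 33 25 1 1 47 0 1 3535 1000 39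
      (by norm_num) (by norm_num) (by norm_num) (by norm_num) (by norm_num) (by norm_num) (by norm_num)
      (by norm_num [cnull]) (by norm_num [cnull]) (by norm_num) (Or.inr (Or.inr (by norm_num))) (Or.inr rfl) (by norm_num) (by norm_num) (by norm_num)
      (tail_six_heavy_sq_33 (p + 33) (by omega)) hR hn hfree (level_six_poly_heavy_sq_33 p hp)
  · exact c025_core_six_heavy_cell_sq M p 34 26 1 1 48 0 1 3047 1000 40
      (by norm_num) (by norm_num) (by norm_num) (by norm_num) (by norm_num) (by norm_num) (by norm_num)
      (by norm_num [cnull]) (by norm_num [cnull]) (by norm_num) (Or.inr (Or.inr (by norm_num))) (Or.inr rfl) (by norm_num) (by norm_num) (by norm_num)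
      (tail_six_heavy_sq_34 (p + 34) (by omega)) hR hn hfree (level_six_poly_heavy_sq_34 p hp)
  · exact c025_core_six_heavy_cell_sq M p 35 27 1 1 49 0 1 2652 1000 41
      (by norm_num) (by norm_num) (by norm_num) (by norm_num) (by norm_num) (by norm_num) (by norm_num)
      (by norm_num [cnull]) (by norm_num [cnull]) (by norm_num) (Or.inr (Or.inr (by norm_num))) (Or.inr rfl) (by norm_num) (by norm_num) (by norm_num)
      (tail_six_heavy_sq_35 (p + 35) (by omega)) hR hn hfree (level_six_poly_heavy_sq_35 p hp)
  · exact c025_core_six_heavy_cell_sq M p 36 28 1 1 50 0 1 2329 1000 42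
      (by norm_num) (by norm_num) (by norm_num) (by norm_num) (by norm_num) (by norm_num) (by norm_num)
      (by norm_num [cnull]) (by norm_num [cnull]) (by norm_num) (Or.inr (Or.inr (by norm_num))) (Or.inr rfl) (by norm_num) (by norm_num) (by norm_num)
      (tail_six_heavy_sq_36 (p + 36) (by omega)) hR hn hfree (level_six_poly_heavy_sq_36 p hp)
  · exact c025_core_six_heavy_cell_sq M p 37 28 1 1 52 0 1 2062 1000 43
      (by norm_num) (by norm_num) (by norm_num) (by norm_num) (by norm_num) (by norm_num) (by norm_num)
      (by norm_num [cnull]) (by norm_num [cnull]) (by norm_num) (Or.inr (Or.inr (by norm_num))) (Or.inr rfl) (by norm_num) (by norm_num) (by norm_num)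
      (tail_six_heavy_sq_37 (p + 37) (by omega)) hR hn hfree (level_six_poly_heavy_sq_37 p hp)
  · exact c025_core_six_heavy_cell_sq M p 38 29 1 1 53 0 1 2168 1000 43
      (by norm_num) (by norm_num) (by norm_num) (by norm_num) (by norm_num) (by norm_num) (by norm_num)
      (by norm_num [cnull]) (by norm_num [cnull]) (by norm_num) (Or.inr (Or.inr (by norm_num))) (Or.inr rfl) (by norm_num) (by norm_num) (by norm_num)
      (tail_six_heavy_sq_38 (p + 38) (by omega)) hR hn hfree (level_six_poly_heavy_sq_38 p hp)
  · exact c025_core_six_heavy_cell_sq M p 39 30 1 1 54 0 1 2263 1000 43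
      (by norm_num) (by norm_num) (by norm_num) (by norm_num) (by norm_num) (by norm_num) (by norm_num)
      (by norm_num [cnull]) (by norm_num [cnull]) (by norm_num) (Or.inr (Or.inr (by norm_num))) (Or.inr rfl) (by norm_num) (by norm_num) (by norm_num)
      (tail_six_heavy_sq_39 (p + 39) (by omega)) hR hn hfree (level_six_poly_heavy_sq_39 p hp)
  · exact c025_core_six_heavy_cell_sq M p 40 31 1 1 55 0 1 2342 1000 43
      (by norm_num) (by norm_num) (by norm_num) (by norm_num) (by norm_num) (by norm_num) (by norm_num)
      (by norm_num [cnull]) (by norm_num [cnull]) (by norm_num) (Or.inr (Or.inr (by norm_num))) (Or.inr rfl) (by norm_num) (by norm_num) (by norm_num)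
      (tail_six_heavy_sq_40 (p + 40) (by omega)) hR hn hfree (level_six_poly_heavy_sq_40 p hp)
  · exact c025_core_six_heavy_cell_sq M p 41 32 1 1 56 0 1 2398 1000 43
      (by norm_num) (by norm_num) (by norm_num) (by norm_num) (by norm_num) (by norm_num) (by norm_num)
      (by norm_num [cnull]) (by norm_num [cnull]) (by norm_num) (Or.inr (Or.inr (by norm_num))) (Or.inr rfl) (by norm_num) (by norm_num) (by norm_num)
      (tail_six_heavy_sq_41 (p + 41) (by omega)) hR hn hfree (level_six_poly_heavy_sq_41 p hp)
  · exact c025_core_six_heavy_cell_sq M p 42 33 1 1 57 0 1 2427 1000 43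
      (by norm_num) (by norm_num) (by norm_num) (by norm_num) (by norm_num) (by norm_num) (by norm_num)
      (by norm_num [cnull]) (by norm_num [cnull]) (by norm_num) (Or.inr (Or.inr (by norm_num))) (Or.inr rfl) (by norm_num) (by norm_num) (by norm_num)
      (tail_six_heavy_sq_42 (p + 42) (by omega)) hR hn hfree (level_six_poly_heavy_sq_42 p hp)
  · exact c025_core_six_heavy_cell_sq M p 43 34 1 1 58 0 1 2427 1000 43
      (by norm_num) (by norm_num) (by norm_num) (by norm_num) (by norm_num) (by norm_num) (by norm_num)
      (by norm_num [cnull]) (by norm_num [cnull]) (by norm_num) (Or.inr (Or.inr (by norm_num))) (Or.inr rfl) (by norm_num) (by norm_num) (by norm_num)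
      (tail_six_heavy_sq_43 (p + 43) (by omega)) hR hn hfree (level_six_poly_heavy_sq_43 p hp)
  · exact c025_core_six_heavy_cell_sq M p 44 35 1 1 59 0 1 2399 1000 43
      (by norm_num) (by norm_num) (by norm_num) (by norm_num) (by norm_num) (by norm_num) (by norm_num)
      (by norm_num [cnull]) (by norm_num [cnull]) (by norm_num) (Or.inr (Or.inr (by norm_num))) (Or.inr rfl) (by norm_num) (by norm_num) (by norm_num)
      (tail_six_heavy_sq_44 (p + 44) (by omega)) hR hn hfree (level_six_poly_heavy_sq_44 p hp)
  · exact c025_core_six_heavy_cell_sq M p 45 36 1 1 60 0 1 2345 1000 43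
      (by norm_num) (by norm_num) (by norm_num) (by norm_num) (by norm_num) (by norm_num) (by norm_num)
      (by norm_num [cnull]) (by norm_num [cnull]) (by norm_num) (Or.inr (Or.inr (by norm_num))) (Or.inr rfl) (by norm_num) (by norm_num) (by norm_num)
      (tail_six_heavy_sq_45 (p + 45) (by omega)) hR hn hfree (level_six_poly_heavy_sq_45 p hp)
  · exact c025_core_six_heavy_cell_sq M p 46 37 1 1 61 0 1 2272 1000 43
      (by norm_num) (by norm_num) (by norm_num) (by norm_num) (by norm_num) (by norm_num) (by norm_num)
      (by norm_num [cnull]) (by norm_num [cnull]) (by norm_num) (Or.inr (Or.inr (by norm_num))) (Or.inr rfl) (by norm_num) (by norm_num) (by norm_num)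
      (tail_six_heavy_sq_46 (p + 46) (by omega)) hR hn hfree (level_six_poly_heavy_sq_46 p hp)
  · exact c025_core_six_heavy_cell_sq M p 47 38 1 1 62 0 1 2184 1000 43
      (by norm_num) (by norm_num) (by norm_num) (by norm_num) (by norm_num) (by norm_num) (by norm_num)
      (by norm_num [cnull]) (by norm_num [cnull]) (by norm_num) (Or.inr (Or.inr (by norm_num))) (Or.inr rfl) (by norm_num) (by norm_num) (by norm_num)
      (tail_six_heavy_sq_47 (p + 47) (by omega)) hR hn hfree (level_six_poly_heavy_sq_47 p hp)
  · exact c025_core_six_heavy_cell_sq M p 48 39 1 1 63 0 1 2088 1000 43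
      (by norm_num) (by norm_num) (by norm_num) (by norm_num) (by norm_num) (by norm_num) (by norm_num)
      (by norm_num [cnull]) (by norm_num [cnull]) (by norm_num) (Or.inr (Or.inr (by norm_num))) (Or.inr rfl) (by norm_num) (by norm_num) (by norm_num)
      (tail_six_heavy_sq_48 (p + 48) (by omega)) hR hn hfree (level_six_poly_heavy_sq_48 p hp)
  · exact c025_core_six_heavy_cell_sq M p 49 40 1 1 64 0 1 1988 1000 43
      (by norm_num) (by norm_num) (by norm_num) (by norm_num) (by norm_num) (by norm_num) (by norm_num)
      (by norm_num [cnull]) (by norm_num [cnull]) (by norm_num) (Or.inr (Or.inr (by norm_num))) (Or.inr rfl) (by norm_num) (by norm_num) (by norm_num)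
      (tail_six_heavy_sq_49 (p + 49) (by omega)) hR hn hfree (level_six_poly_heavy_sq_49 p hp)
  · exact c025_core_six_heavy_cell_sq M p 50 41 1 1 65 0 1 1889 1000 43
      (by norm_num) (by norm_num) (by norm_num) (by norm_num) (by norm_num) (by norm_num) (by norm_num)
      (by norm_num [cnull]) (by norm_num [cnull]) (by norm_num) (Or.inr (Or.inr (by norm_num))) (Or.inr rfl) (by norm_num) (by norm_num) (by norm_num)
      (tail_six_heavy_sq_50 (p + 50) (by omega)) hR hn hfree (level_six_poly_heavy_sq_50 p hp)

/-- **THEOREM C₆ WITH THE SQUARE MULTIPLICITY, GIVEN LEVEL `5`**: level `5` for all `p ≥ 51` implies level `6`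
for all `p ≥ 52`. -/
theorem c025_six_of_five_heavy_sq' (h5 : ∀ (M : Matroid α) [M.Finite] (p : ℕ), 51 ≤ p → RLS M p 5) :
    ∀ (M : Matroid α) [M.Finite] (p : ℕ), 52 ≤ p → RLS M p 6 := by
  intro M _ p hp
  rcases Nat.lt_or_ge p 53 with hlt | hge
  · have hP : p = 52 := by omega
    subst hP
    refine rls_six_at_of_core 52 (by norm_num) (fun M _ => h5 M 51 (by norm_num)) ?_ M
    intro M _ d hd hR hn hfree
    rcases Nat.lt_or_ge d 51 with hd50 | hd51
    · exact c025_core_six_bounded_corank_heavy_sq' M 52 d (by norm_num) hd (by omega) hR hn hfree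
    · exact c025_core_six_fortythree_fiftytwo M 52 (by norm_num) hR (by omega) hfree
  · refine rls_succ_large (α := α) 5 6 52 ?_ ?_ ?_ M p hge (by omega)
    · intro M' _ p' hP _
      exact h5 M' p' (by omega)
    · intro M' _ p' _ hn _
      rcases Nat.lt_or_ge M'.E.ncard (p' + 6) with h | h
      · exact RLS_of_ncard_lt M' h
      · exact RLS_of_ncard_eq M' (by omega)
    · intro M' _ p' hP hR hbig _ hfree
      rcases Nat.lt_or_ge M'.E.ncard (p' + 51) with h | h
      · exact c025_core_six_bounded_corank_heavy_sq' M' p' (M'.E.ncard - p') hP (by omega) (by omega) hR (by omega) hfree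
      · exact c025_core_six_fortythree_fiftytwo M' p' (by omega) hR (by omega) hfree

/-- **C-025 AT LEVEL `6` FOR EVERY `p ≥ 52`, EVERY FINITE MATROID, UNCONDITIONAL** — `c025_six_of_five_heavy_sq'` on
p7's level-`5` row `c025_five_large_part33 (33 ≤ p)`. -/
theorem c025_six_large_fifty_two (M : Matroid α) [M.Finite] (p : ℕ) (hp : 52 ≤ p) : RLS M p 6 :=
  c025_six_of_five_heavy_sq' (fun M _ p hp => c025_five_large_part33 M p (by omega)) M p hp

/-- The same in the vocabulary of `C025`: the level-`6` frontier of the counting route is every `p ≥ 52`. -/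
theorem c025_six_large_fifty_two' (M : Matroid α) [M.Finite] (p : ℕ) (hp : 52 ≤ p) :
    phiK p 6 * ({A : Set α | A ⊆ M.E ∧ M.eRk A = (p : ℕ∞) ∧ M.eRk (M.E \ A) = (6 : ℕ∞)}.ncard : ℚ) ≤
      ({A : Set α | A ⊆ M.E ∧ (6 : ℕ∞) < M.eRk A ∧ M.eRk A < (p : ℕ∞)}.ncard : ℚ) :=
  c025_six_large_fifty_two M p hp

end ThmN

end PercRepro
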